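import Literature.ModelTheory.Zilber.EACDensityOscillatory
import Literature.ModelTheory.Zilber.EACDensityGrowth
import HarnessLib

/-!
# Mantova–Masser's unprojected-density question for constant fibres: the complete answer

Literature module (Zilber's Exponential-Algebraic-Closedness programme, `EC(3,2)` ladder node
"density of unprojected exponential points").  HONEST FRAMING: as in `EACDensityQuestion`,
`EACDensityFamilies`, `EACDensityGrowth`, `EACDensityOscillatory`, everything here concerns the
auxiliary question of Mantova–Masser [MantovaMasser2023, §1 Further remarks, p. 5] on the Zariski
density of the exponential points `W ∩ Γ_exp` of a surface `W ⊆ ℂ² × (ℂ×)²`, for ONE family of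
(multiplicatively degenerate) surfaces.  It is a modest rung far below Zilber's conjecture, which is
NOT Schanuel's conjecture and does not imply it; nothing here is evidence for either.

## The family and the answer

For `p ∈ ℂ[x]` and `z₀ ∈ ℂ` let `S = {x₁ = p(x₀), y₀ = e^{z₀}}` (`graphPolySurface p (C e^{z₀})`).
Its exponential points are `(z₀ + 2πik, p(z₀ + 2πik), e^{z₀}, e^{P(k)})`, `k ∈ ℤ`, where
`P(t) = p(z₀ + 2πi t) = Σ bⱼ tʲ` is the PHASE POLYNOMIAL (`phasePoly p z₀`).

**Theorem (`unprojectedDense_const_iff`, `unprojectedDense_const_iff_infinite`).** The following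
are equivalent: (i) `S ∩ Γ_exp` is Zariski dense in `S` (`UnprojectedDense S`); (ii) NOT every
non-constant coefficient `bⱼ` (`j ≥ 1`) of `P` lies in `ℚ · 2πi`; (iii) `y₁ = e^{P(k)}` takes
infinitely many values on the exponential points.  With the case certificate
(`mmCase_and_unprojectedDense_const_iff`, `deg p ≥ 2`): inside Mantova–Masser's case
(dim-pi-S-1-free) this family contains surfaces with either answer, decided by the ARITHMETIC of
the phases — the resonant parabola and the cubic of `EACDensityOscillatory` are the two simplest
instances.  (These surfaces are never multiplicatively free, so the free form of the question —
the one Zilber's conjecture needs — is untouched and stays OPEN.)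

## The three regimes of the proof (all unconditional, no `sorry`)

* (ii) fails ⇒ ¬(i) (`not_unprojectedDense_const_of_ratPhases`, Part D): with a common
  denominator `N`, `P(k) ∈ b₀ + (1/N)ℤ · 2πi` on `ℤ`, so `y₁` takes at most `N` values and a product
  of `y₁ - c` kills the exponential points (`EACDensityOscillatory.not_unprojectedDense_const_of_finite`).
* DRIFT (Part B/C): some `bⱼ`, `j ≥ 1`, has `Re bⱼ ≠ 0`.  Then `Re P(k)` is a non-constant real
  polynomial in `k` (`rePart`, `eval_rePart`) and dominates `±(ε k)` eventually
  (`eventually_mul_le_eval_of_leadingCoeff_pos`, from `Polynomial.isEquivalent_atTop_lead`), so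
  `|y₁| = e^{Re P(k)}` decays or grows super-polynomially against `|x₀| ≍ k`; the eliminations of
  `EACDensityFamilies` (`unprojectedDense_graphPolySurface_of_seq`) resp. `EACDensityGrowth`
  (`unprojectedDense_graphPolySurface_of_seq_growth`) conclude
  (`unprojectedDense_const_of_negDrift`, `unprojectedDense_const_of_posDrift`).  This covers ALL
  drift rates `k, k², …, k^{deg p}` — the earlier files only instantiated the top-coefficient
  criteria `Re(a(σ2πi)^d) ≠ 0`.
* OSCILLATORY (Part A/E): all `Re bⱼ = 0` (`j ≥ 1`), i.e. `|y₁|` constant, and some phase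
  `βⱼ = bⱼ/(2πi) ∈ ℝ` is irrational.  Let `s` be the LARGEST such `j` and `N` a common denominator
  of the (rational) phases above `s`; along `k ∈ Nℕ` those phases are integers and drop out of
  `e^{P(k)}`, which becomes `e^{g(m)}` for a polynomial `g` of degree `s` with irrational top phase
  `s! β_s N^s` (`unprojectedDense_const_of_irrational_phase`) — and then the differencing argument
  of `EACDensityOscillatory` applies verbatim along the sub-progression
  (`unprojectedDense_const_of_phasePoly`: the `(s-1)`-st multiplicative difference of `y₁` is a
  non-periodic rotation, which cannot cluster in the finite root set forced by a polynomial
  relation).  This is Weyl's second reduction step in the proof of equidistribution of polynomial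
  sequences [Korobov1992, Thm 26, p. 108: "Denote by q the common denominator of coefficients
  α_{s+1}, …, α_n and write x = y + qz"], in the crude pigeonhole form that suffices here.

Examples (Part G): `{x₁ = x₀³/(4π²) + i x₀², y₀ = 1}` (top phase an integer, `q = 1`) and
`{x₁ = x₀³/(8π²) + i x₀², y₀ = 1}` (top phase a half-integer, `q = 2`) have Zariski-dense
exponential points; both are in case (dim-pi-S-1-free).

Sources: [MantovaMasser2023] V. Mantova, D. Masser, arXiv:2303.05592, Thm. 1.2 (p. 4), §1 Further
remarks (p. 5); [Korobov1992] N. M. Korobov, *Exponential sums and their applications*, Kluwer 1992,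
Thm 26 (pp. 105–110); Lindemann 1882 via the tree theorem `transcendental_pi_holds`.  The arguments
are elementary and presumably folklore; no claim of priority.  Nothing here is, or is used as,
evidence for Schanuel's conjecture; `EC(3,2)` itself stays OPEN.
-/

noncomputable section

open Filter Topology MvPolynomial Complex fwdDiff Asymptotics

namespace Literature.ModelTheory.Zilber

open Literature.NumberTheory.Transcendental Literature.ModelTheory.ExponentialFields

/-! ## Part A. Phase polynomials along arithmetic progressions -/

section PhasePoly

/-- **Density from an irrational top phase along an arithmetic progression.** Let
`S = {x₁ = p(x₀), y₀ = c}` with `c = e^{z₀}`, and suppose that along the progression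
`z₀ + 2πi(r + qk)` (`q ≥ 1`) the values `e^{p}` are `e^{g(k)}` for a polynomial `g` of positive
degree whose real part is constant on `ℕ` and whose top phase `θ` (`θ · 2πi = (deg g)! · lc g`) is
irrational. Then the exponential points of `S` are Zariski dense. This is
`unprojectedDense_const_of_irrational` (the case `q = 1`, `r = 0`, `g(t) = p(z₀ + 2πi t)`) with the
freedom to pass to a sub-progression and to discard integer phases — Weyl's second differencing
step [cite: Korobov1992, Thm 26, p. 108]. (new in this file) [folklore] -/
theorem unprojectedDense_const_of_phasePoly {p : Polynomial ℂ} {z₀ c : ℂ} (hc : exp z₀ = c)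
    {q : ℕ} (hq : 0 < q) (r : ℕ) (g : Polynomial ℂ) (hd : 0 < g.natDegree)
    (hg : ∀ k : ℕ, exp (p.eval (z₀ + ((r + q * k : ℕ) : ℂ) * (2 * Real.pi * I))) =
      exp (g.eval (k : ℂ)))
    (hR : ∀ k : ℕ, (g.eval (k : ℂ)).re = (g.eval 0).re) {θ : ℝ}
    (hθ : (θ : ℂ) * (2 * Real.pi * I) = (g.natDegree.factorial : ℂ) * g.leadingCoeff)
    (hirr : Irrational θ) :
    UnprojectedDense (graphPolySurface p (Polynomial.C c)) := by
  -- the exponential points along the sub-progression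
  set z : ℕ → ℂ := fun k => z₀ + ((r + q * k : ℕ) : ℂ) * (2 * Real.pi * I) with hz_def
  set w : ℕ → ℂ := fun k => exp (p.eval (z k)) with hw_def
  have hwg : ∀ k, w k = exp (g.eval (k : ℂ)) := fun k => hg k
  have hexp₁ : ∀ k, exp (z k) = (Polynomial.C c).eval (w k) := fun k => by
    rw [Polynomial.eval_C]
    show exp (z₀ + ((r + q * k : ℕ) : ℂ) * (2 * Real.pi * I)) = c
    rw [Complex.exp_add, hc, Complex.exp_nat_mul_two_pi_mul_I, mul_one]
  have hexp₂ : ∀ k, exp (p.eval (z k)) = w k := fun k => rfl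
  -- `|z_k| → ∞`
  have hzlim : Tendsto (fun k => ‖z k‖) atTop atTop := by
    refine tendsto_norm_atTop_of_le (K := fun k : ℕ => (k : ℝ)) tendsto_natCast_atTop_atTop
      Real.two_pi_pos (b := ‖z₀‖) fun k => ?_
    have hk : (k : ℝ) ≤ ((r + q * k : ℕ) : ℝ) := by
      exact_mod_cast (le_add_left (Nat.le_mul_of_pos_left k hq) : k ≤ r + q * k)
    have h1 : ‖((r + q * k : ℕ) : ℂ) * (2 * Real.pi * I)‖ = 2 * Real.pi * ((r + q * k : ℕ) : ℝ) := by
      rw [norm_mul, Complex.norm_natCast, norm_mul, norm_mul, Complex.norm_I, Complex.norm_real,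
        Real.norm_eq_abs, abs_of_pos Real.pi_pos, Complex.norm_two]
      ring
    have h2 := norm_sub_le (z₀ + ((r + q * k : ℕ) : ℂ) * (2 * Real.pi * I)) z₀
    rw [add_sub_cancel_left, h1] at h2
    have h3 : 2 * Real.pi * (k : ℝ) ≤ 2 * Real.pi * ((r + q * k : ℕ) : ℝ) :=
      mul_le_mul_of_nonneg_left hk Real.two_pi_pos.le
    show 2 * Real.pi * k - ‖z₀‖ ≤ ‖z₀ + ((r + q * k : ℕ) : ℂ) * (2 * Real.pi * I)‖
    linarith
  -- `|w_k| = R` constant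
  have hRpos : 0 < Real.exp (g.eval 0).re := Real.exp_pos _
  have hwR : ∀ k, Real.exp (g.eval 0).re ≤ ‖w k‖ ∧ ‖w k‖ ≤ Real.exp (g.eval 0).re := fun k => by
    have : ‖w k‖ = Real.exp (g.eval 0).re := by rw [hwg, Complex.norm_exp, hR k]
    exact ⟨this.ge, this.le⟩
  -- `F = Δ^{d-1} g` has constant difference `θ · 2πi`
  obtain ⟨F, hF⟩ : ∃ F : ℂ → ℂ, F = (fwdDiff (1 : ℂ))^[g.natDegree - 1] (fun x => g.eval x) :=
    ⟨_, rfl⟩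
  have hΔF : ∀ x, Δ_[1] F x = (θ : ℂ) * (2 * Real.pi * I) := fun x => by
    have e : (g.natDegree - 1).succ = g.natDegree := Nat.succ_pred_eq_of_pos hd
    have h1 : Δ_[1] F = (fwdDiff (1 : ℂ))^[g.natDegree] (fun x => g.eval x) := by
      rw [hF, ← Function.iterate_succ_apply' (f := fwdDiff (1 : ℂ)), e]
    have h2 := congrFun (Polynomial.fwdDiff_iter_degree_eq_factorial g) x
    rw [h1, h2, Pi.smul_apply, smul_eq_mul, Pi.natCast_apply, hθ]
    ring
  -- the `(d-1)`-st multiplicative difference of `w` is the rotation `e^{F(0)} ζ^k`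
  have hrot : ∀ k, mulShift^[g.natDegree - 1] w k =
      exp (F 0) * exp ((θ : ℂ) * (2 * Real.pi * I)) ^ k := by
    intro k
    have hwg' : w = fun k => exp ((fun n : ℕ => g.eval (n : ℂ)) k) := funext hwg
    have key : ((fwdDiff (1 : ℕ))^[g.natDegree - 1] fun n : ℕ => g.eval (n : ℂ)) k = F (k : ℂ) := by
      rw [hF]
      exact congrFun (fwdDiff_iter_natCast (fun x => g.eval x) (g.natDegree - 1)) k
    rw [hwg', iterate_mulShift_exp]
    dsimp only
    rw [key, eq_add_mul_of_fwdDiff_eq_const hΔF k, Complex.exp_add, Complex.exp_nat_mul]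
  -- `ζ = e^{2πiθ}`: modulus one, not a root of unity since `θ ∉ ℚ`
  have hζ : ‖exp ((θ : ℂ) * (2 * Real.pi * I))‖ = 1 := by
    have : (θ : ℂ) * (2 * Real.pi * I) = ((θ * (2 * Real.pi) : ℝ) : ℂ) * I := by push_cast; ring
    rw [this, Complex.norm_exp_ofReal_mul_I]
  have hroot : ∀ j : ℕ, 0 < j → exp ((θ : ℂ) * (2 * Real.pi * I)) ^ j ≠ 1 := by
    intro j hj h
    rw [← Complex.exp_nat_mul, Complex.exp_eq_one_iff] at h
    obtain ⟨n, hn⟩ := h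
    have h2 : ((j : ℂ) * θ) * (2 * Real.pi * I) = (n : ℂ) * (2 * Real.pi * I) := by
      rw [← hn]; ring
    have h3 := mul_right_cancel₀ Complex.two_pi_I_ne_zero h2
    have h4 : ((j : ℝ) * θ : ℝ) = (n : ℝ) := by exact_mod_cast h3
    exact (hirr.natCast_mul (Nat.pos_iff_ne_zero.mp hj)).ne_int n h4
  exact unprojectedDense_graphPolySurface_of_rotation p (Polynomial.C c) z w hzlim hRpos hwR
    (g.natDegree - 1) (Complex.exp_ne_zero _) hζ hroot hrot hexp₁ hexp₂

end PhasePoly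

/-! ## Part B. Drift regimes: a linear drift of `Re p` along a progression suffices -/

section Drift

/-- The exponential points along the shifted progression `z₀ + (k + K₀)·σ2πi` (`σ = ±1`), with a
scale function dominating the index linearly: the parametrisation facts used by both drift
regimes. [folklore] -/
theorem driftSeq_aux {p : Polynomial ℂ} {z₀ c : ℂ} (hc : exp z₀ = c) (σ : ℤ)
    (hσ : σ = 1 ∨ σ = -1) {ε : ℝ} (hε : 0 < ε) {K₀ : ℕ} (hK₀ : 1 ≤ K₀) (f : ℂ → ℝ)
    (hf : ∀ k : ℕ, ε * ((k + K₀ : ℕ) : ℝ) ≤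
      f (p.eval (z₀ + ((k + K₀ : ℕ) : ℂ) * ((σ : ℂ) * (2 * Real.pi * I))))) :
    Tendsto (fun k : ℕ => ‖z₀ + ((k + K₀ : ℕ) : ℂ) * ((σ : ℂ) * (2 * Real.pi * I))‖) atTop atTop ∧
    Tendsto (fun k : ℕ => f (p.eval (z₀ + ((k + K₀ : ℕ) : ℂ) * ((σ : ℂ) * (2 * Real.pi * I)))))
      atTop atTop ∧
    (∀ k : ℕ, ‖z₀ + ((k + K₀ : ℕ) : ℂ) * ((σ : ℂ) * (2 * Real.pi * I))‖ ≤
      (‖z₀‖ + 2 * Real.pi) / ε *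
        f (p.eval (z₀ + ((k + K₀ : ℕ) : ℂ) * ((σ : ℂ) * (2 * Real.pi * I))))) ∧
    (∀ k : ℕ, exp (z₀ + ((k + K₀ : ℕ) : ℂ) * ((σ : ℂ) * (2 * Real.pi * I))) = c) := by
  set s : ℂ := (σ : ℂ) * (2 * Real.pi * I) with hs_def
  have hs_norm : ‖s‖ = 2 * Real.pi := by
    rw [hs_def]
    rcases hσ with rfl | rfl <;> simp [abs_of_pos Real.pi_pos]
  have hn1 : ∀ k : ℕ, (1 : ℝ) ≤ ((k + K₀ : ℕ) : ℝ) := fun k => by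
    exact_mod_cast le_trans hK₀ (Nat.le_add_left _ _)
  have hns : ∀ k : ℕ, ‖((k + K₀ : ℕ) : ℂ) * s‖ = ((k + K₀ : ℕ) : ℝ) * (2 * Real.pi) := fun k => by
    rw [norm_mul, Complex.norm_natCast, hs_norm]
  have hflim : Tendsto (fun k : ℕ => f (p.eval (z₀ + ((k + K₀ : ℕ) : ℂ) * s))) atTop atTop := by
    refine tendsto_atTop_mono hf ?_
    have h1 : Tendsto (fun k : ℕ => ((k + K₀ : ℕ) : ℝ)) atTop atTop :=
      tendsto_natCast_atTop_atTop.comp (tendsto_add_atTop_nat K₀)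
    exact h1.const_mul_atTop hε
  refine ⟨?_, hflim, fun k => ?_, fun k => ?_⟩
  · refine tendsto_norm_atTop_of_le (K := fun k : ℕ => (k : ℝ)) tendsto_natCast_atTop_atTop
      Real.two_pi_pos (b := ‖z₀‖) fun k => ?_
    have h2 := norm_sub_le (z₀ + ((k + K₀ : ℕ) : ℂ) * s) z₀
    rw [add_sub_cancel_left, hns] at h2
    have hk : (k : ℝ) ≤ ((k + K₀ : ℕ) : ℝ) := by exact_mod_cast Nat.le_add_right k K₀
    have h3 : 2 * Real.pi * (k : ℝ) ≤ ((k + K₀ : ℕ) : ℝ) * (2 * Real.pi) := by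
      nlinarith [Real.pi_pos]
    show 2 * Real.pi * k - ‖z₀‖ ≤ ‖z₀ + ((k + K₀ : ℕ) : ℂ) * s‖
    linarith
  · have h1 : ‖z₀ + ((k + K₀ : ℕ) : ℂ) * s‖ ≤ ‖z₀‖ + ((k + K₀ : ℕ) : ℝ) * (2 * Real.pi) := by
      refine (norm_add_le _ _).trans ?_
      rw [hns]
    have h2 : (‖z₀‖ + 2 * Real.pi) / ε * (ε * ((k + K₀ : ℕ) : ℝ)) ≤
        (‖z₀‖ + 2 * Real.pi) / ε * f (p.eval (z₀ + ((k + K₀ : ℕ) : ℂ) * s)) :=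
      mul_le_mul_of_nonneg_left (hf k) (by positivity)
    have h3 : (‖z₀‖ + 2 * Real.pi) / ε * (ε * ((k + K₀ : ℕ) : ℝ)) =
        (‖z₀‖ + 2 * Real.pi) * ((k + K₀ : ℕ) : ℝ) := by
      field_simp
    have h4 := hn1 k
    nlinarith [norm_nonneg z₀, Real.pi_pos]
  · rw [Complex.exp_add, hc, hs_def, ← mul_assoc]
    have : ((k + K₀ : ℕ) : ℂ) * (σ : ℂ) = ((((k + K₀ : ℕ) : ℤ) * σ : ℤ) : ℂ) := by push_cast; ring
    rw [this, Complex.exp_int_mul_two_pi_mul_I, mul_one]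

/-- **Negative linear drift gives density.** If `Re p(z₀ + k·σ2πi) ≤ -εk` eventually (`σ = ±1`,
`ε > 0`), then `|y₁| = e^{Re p}` decays super-polynomially against `|x₀| ≍ k` on the exponential
points, and the super-decay elimination of `EACDensityFamilies` applies. [folklore] -/
theorem unprojectedDense_const_of_negDrift {p : Polynomial ℂ} {z₀ c : ℂ} (hc : exp z₀ = c)
    (σ : ℤ) (hσ : σ = 1 ∨ σ = -1) {ε : ℝ} (hε : 0 < ε)
    (hdrift : ∀ᶠ k : ℕ in atTop,
      ε * k ≤ -(p.eval (z₀ + (k : ℂ) * ((σ : ℂ) * (2 * Real.pi * I)))).re) :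
    UnprojectedDense (graphPolySurface p (Polynomial.C c)) := by
  obtain ⟨K₁, hK₁⟩ := eventually_atTop.mp hdrift
  obtain ⟨hz, hK, hzle, hexpc⟩ := driftSeq_aux hc σ hσ hε (le_max_right K₁ 1) (fun u => -u.re)
    fun k => hK₁ _ (le_trans (le_max_left _ _) (Nat.le_add_left _ _))
  set z : ℕ → ℂ := fun k => z₀ + ((k + max K₁ 1 : ℕ) : ℂ) * ((σ : ℂ) * (2 * Real.pi * I))
    with hz_def
  set w : ℕ → ℂ := fun k => exp (p.eval (z k)) with hw_def
  have hw_le : ∀ k, ‖w k‖ ≤ Real.exp (-(-(p.eval (z k)).re)) := fun k => by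
    rw [hw_def, Complex.norm_exp, neg_neg]
  have hdec : ∀ N : ℕ, Tendsto (fun k => ‖w k‖ * ‖z k‖ ^ N) atTop (𝓝 0) :=
    superdecay_of_le hK hzle hw_le
  exact unprojectedDense_graphPolySurface_of_seq p (Polynomial.C c) z w hz
    (fun k => Complex.exp_ne_zero _) hdec (fun k => by rw [Polynomial.eval_C]; exact hexpc k)
    fun k => rfl

/-- **Positive linear drift gives density.** If `Re p(z₀ + k·σ2πi) ≥ εk` eventually, then `|y₁|`
grows super-polynomially and the reversed elimination of `EACDensityGrowth` applies. [folklore] -/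
theorem unprojectedDense_const_of_posDrift {p : Polynomial ℂ} {z₀ c : ℂ} (hc : exp z₀ = c)
    (σ : ℤ) (hσ : σ = 1 ∨ σ = -1) {ε : ℝ} (hε : 0 < ε)
    (hdrift : ∀ᶠ k : ℕ in atTop,
      ε * k ≤ (p.eval (z₀ + (k : ℂ) * ((σ : ℂ) * (2 * Real.pi * I)))).re) :
    UnprojectedDense (graphPolySurface p (Polynomial.C c)) := by
  obtain ⟨K₁, hK₁⟩ := eventually_atTop.mp hdrift
  obtain ⟨hz, hK, hzle, hexpc⟩ := driftSeq_aux hc σ hσ hε (le_max_right K₁ 1) (fun u => u.re)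
    fun k => hK₁ _ (le_trans (le_max_left _ _) (Nat.le_add_left _ _))
  set z : ℕ → ℂ := fun k => z₀ + ((k + max K₁ 1 : ℕ) : ℂ) * ((σ : ℂ) * (2 * Real.pi * I))
    with hz_def
  set w : ℕ → ℂ := fun k => exp (p.eval (z k)) with hw_def
  have hw_le : ∀ k, ‖(w k)⁻¹‖ ≤ Real.exp (-(p.eval (z k)).re) := fun k => by
    rw [hw_def, norm_inv, Complex.norm_exp, Real.exp_neg]
  have hgrow : ∀ N : ℕ, Tendsto (fun k => ‖(w k)⁻¹‖ * ‖z k‖ ^ N) atTop (𝓝 0) :=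
    superdecay_of_le hK hzle hw_le
  exact unprojectedDense_graphPolySurface_of_seq_growth p (Polynomial.C c) z w hz
    (fun k => Complex.exp_ne_zero _) hgrow (fun k => by rw [Polynomial.eval_C]; exact hexpc k)
    fun k => rfl

end Drift

/-! ## Part C. The real-part polynomial and eventual linear domination -/

section RePart

/-- The real-part polynomial `Σ Re(bᵢ) Xⁱ ∈ ℝ[X]` of `Q = Σ bᵢ Xⁱ ∈ ℂ[X]`. [folklore] -/
def rePart (Q : Polynomial ℂ) : Polynomial ℝ :=
  ∑ i ∈ Finset.range (Q.natDegree + 1), Polynomial.monomial i (Q.coeff i).re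

/-- Coefficients of the real-part polynomial. [folklore] -/
theorem coeff_rePart (Q : Polynomial ℂ) (i : ℕ) : (rePart Q).coeff i = (Q.coeff i).re := by
  classical
  rw [rePart, Polynomial.finsetSum_coeff]
  simp only [Polynomial.coeff_monomial]
  rw [Finset.sum_ite_eq' (Finset.range (Q.natDegree + 1)) i fun j => (Q.coeff j).re]
  split_ifs with h
  · rfl
  · rw [Finset.mem_range, not_lt] at h
    rw [Polynomial.coeff_eq_zero_of_natDegree_lt (Nat.lt_of_succ_le h), Complex.zero_re]

/-- `(rePart Q)(x) = Re Q(x)` for real `x`. [folklore] -/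
theorem eval_rePart (Q : Polynomial ℂ) (x : ℝ) : (rePart Q).eval x = (Q.eval (x : ℂ)).re := by
  rw [rePart, Polynomial.eval_finsetSum, Polynomial.eval_eq_sum_range, Complex.re_sum]
  refine Finset.sum_congr rfl fun i _ => ?_
  rw [Polynomial.eval_monomial, ← Complex.ofReal_pow, Complex.re_mul_ofReal]

/-- A real polynomial of positive degree with positive leading coefficient eventually dominates
`(lc/2)·k` on `ℕ`. [folklore] -/
theorem eventually_mul_le_eval_of_leadingCoeff_pos (R : Polynomial ℝ) (hd : 0 < R.natDegree)
    (hlc : 0 < R.leadingCoeff) :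
    ∀ᶠ k : ℕ in atTop, R.leadingCoeff / 2 * (k : ℝ) ≤ R.eval (k : ℝ) := by
  have hlo := (Polynomial.isEquivalent_atTop_lead R).isLittleO.def (by norm_num : (0 : ℝ) < 1 / 2)
  have hreal : ∀ᶠ x : ℝ in atTop, R.leadingCoeff / 2 * x ≤ R.eval x := by
    filter_upwards [hlo, eventually_ge_atTop (1 : ℝ)] with x hx hx1
    have hv : 0 ≤ R.leadingCoeff * x ^ R.natDegree := by positivity
    simp only [Pi.sub_apply, Real.norm_eq_abs, abs_of_nonneg hv] at hx
    have h1 := (abs_le.mp hx).1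
    have h2 : x ≤ x ^ R.natDegree := le_self_pow₀ hx1 hd.ne'
    nlinarith
  exact tendsto_natCast_atTop_atTop.eventually hreal

end RePart

/-! ## Part D. The phase polynomial; rational phases give finitely many values of `y₁` -/

section RationalPhases

/-- The polynomial `t ↦ p(z₀ + 2πi t)`, whose values at `k ∈ ℤ` are the exponents `log y₁` on the
exponential points `(z₀ + 2πik, p(z₀ + 2πik), e^{z₀}, e^{p(z₀ + 2πik)})` of `{x₁ = p(x₀), y₀ = e^{z₀}}`.
Its coefficients `bⱼ` (`j ≥ 1`) divided by `2πi` are the PHASES of the surface at `z₀`. [folklore] -/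
def phasePoly (p : Polynomial ℂ) (z₀ : ℂ) : Polynomial ℂ :=
  p.comp (Polynomial.C (2 * Real.pi * I) * Polynomial.X + Polynomial.C z₀)

/-- `phasePoly p z₀ (x) = p(z₀ + 2πi x)`. [folklore] -/
theorem eval_phasePoly (p : Polynomial ℂ) (z₀ x : ℂ) :
    (phasePoly p z₀).eval x = p.eval (z₀ + x * (2 * Real.pi * I)) := by
  simp only [phasePoly, Polynomial.eval_comp, Polynomial.eval_add, Polynomial.eval_mul,
    Polynomial.eval_C, Polynomial.eval_X]
  ring_nf

/-- `deg phasePoly p z₀ = deg p`. [folklore] -/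
theorem natDegree_phasePoly (p : Polynomial ℂ) (z₀ : ℂ) :
    (phasePoly p z₀).natDegree = p.natDegree := by
  rw [phasePoly, Polynomial.natDegree_comp, Polynomial.natDegree_linear Complex.two_pi_I_ne_zero,
    mul_one]

/-- The leading coefficient of the phase polynomial: `lc p · (2πi)^{deg p}`. [folklore] -/
theorem leadingCoeff_phasePoly (p : Polynomial ℂ) (z₀ : ℂ) :
    (phasePoly p z₀).leadingCoeff = p.leadingCoeff * (2 * Real.pi * I) ^ p.natDegree := by
  have hlin : (Polynomial.C (2 * Real.pi * I) * Polynomial.X + Polynomial.C z₀).natDegree = 1 :=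
    Polynomial.natDegree_linear Complex.two_pi_I_ne_zero
  rw [phasePoly, Polynomial.leadingCoeff_comp (by rw [hlin]; exact one_ne_zero),
    Polynomial.leadingCoeff_linear Complex.two_pi_I_ne_zero]

/-- A common denominator for finitely many rationals. [folklore] -/
theorem exists_common_den (S : Finset ℕ) (r : ℕ → ℚ) :
    ∃ N : ℕ, 0 < N ∧ ∀ j ∈ S, ∃ a : ℤ, (r j : ℚ) * N = a := by
  classical
  refine ⟨∏ i ∈ S, (r i).den, Finset.prod_pos fun i _ => (r i).den_pos, fun j hj => ?_⟩
  refine ⟨(r j).num * ∏ i ∈ S.erase j, ((r i).den : ℤ), ?_⟩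
  rw [← Finset.mul_prod_erase S (fun i => (r i).den) hj]
  push_cast
  rw [← mul_assoc, Rat.mul_den_eq_num]

/-- From phases in `ℚ` to phases in `(1/N)ℤ`: if the coefficients `bⱼ`, `j > s`, of `P` lie in
`ℚ · 2πi`, then for a common denominator `N ≥ 1` all `bⱼ N` (`j > s`) lie in `ℤ · 2πi`. [folklore] -/
theorem exists_int_phases_of_rat_phases (P : Polynomial ℂ) {s : ℕ}
    (h : ∀ j, s < j → ∃ r : ℚ, P.coeff j = (r : ℂ) * (2 * Real.pi * I)) :
    ∃ N : ℕ, 0 < N ∧ ∀ j, s < j → ∃ a : ℤ, P.coeff j * N = a * (2 * Real.pi * I) := by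
  classical
  choose! r hr using h
  obtain ⟨N, hN, hNr⟩ := exists_common_den (Finset.range (P.natDegree + 1)) r
  refine ⟨N, hN, fun j hj => ?_⟩
  by_cases hjd : j ∈ Finset.range (P.natDegree + 1)
  · obtain ⟨a, ha⟩ := hNr j hjd
    refine ⟨a, ?_⟩
    have hac : ((r j : ℚ) : ℂ) * (N : ℂ) = (a : ℂ) := by exact_mod_cast ha
    rw [hr j hj, mul_right_comm, hac]
  · refine ⟨0, ?_⟩
    rw [Finset.mem_range, not_lt] at hjd
    rw [Polynomial.coeff_eq_zero_of_natDegree_lt (Nat.lt_of_succ_le hjd)]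
    simp

/-- **Rational phases: `y₁` takes finitely many values on the exponential points.** If every
non-constant coefficient `bⱼ` of `P(t) = p(z₀ + 2πi t)` satisfies `bⱼ N ∈ ℤ · 2πi`, then
`e^{p(z₀ + 2πik)}`, `k ∈ ℤ`, takes at most `N` values (`e^{b₀}` times `N`-th roots of unity).
[folklore] -/
theorem exists_finset_of_ratPhases (p : Polynomial ℂ) (z₀ : ℂ) {N : ℕ} (hN : 0 < N)
    (hrat : ∀ j, 0 < j → ∃ a : ℤ, (phasePoly p z₀).coeff j * N = a * (2 * Real.pi * I)) :
    ∃ F : Finset ℂ, ∀ k : ℤ, exp (p.eval (z₀ + k * (2 * Real.pi * I))) ∈ F := by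
  classical
  set P := phasePoly p z₀ with hP
  choose! a ha using hrat
  refine ⟨(Finset.range N).image fun m : ℕ =>
    exp (P.coeff 0) * exp ((m : ℂ) / N * (2 * Real.pi * I)), fun k => ?_⟩
  have hNc : (N : ℂ) ≠ 0 := by exact_mod_cast hN.ne'
  have hNz : (N : ℤ) ≠ 0 := by exact_mod_cast hN.ne'
  obtain ⟨M, hM⟩ : ∃ M : ℤ, M = ∑ i ∈ Finset.Ico 1 (P.natDegree + 1), a i * k ^ i := ⟨_, rfl⟩
  have hsum : P.eval (k : ℂ) = P.coeff 0 + (M : ℂ) / N * (2 * Real.pi * I) := by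
    rw [Polynomial.eval_eq_sum_range,
      ← Finset.sum_range_add_sum_Ico _ (Nat.succ_le_succ (Nat.zero_le P.natDegree)),
      Finset.sum_range_one, pow_zero, mul_one, hM]
    congr 1
    push_cast
    rw [Finset.sum_div, Finset.sum_mul]
    refine Finset.sum_congr rfl fun i hi => ?_
    have h := ha i (Finset.mem_Ico.mp hi).1
    rw [div_mul_eq_mul_div, eq_div_iff hNc]
    linear_combination (k : ℂ) ^ i * h
  have hdiv : (M : ℂ) / N * (2 * Real.pi * I) =
      ((M % N : ℤ) : ℂ) / N * (2 * Real.pi * I) + ((M / N : ℤ) : ℂ) * (2 * Real.pi * I) := by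
    have e : ((M % N : ℤ) : ℂ) + ((N : ℤ) : ℂ) * ((M / N : ℤ) : ℂ) = (M : ℂ) := by
      exact_mod_cast Int.emod_add_mul_ediv M N
    rw [Int.cast_natCast] at e
    rw [← e, add_div, mul_div_cancel_left₀ _ hNc]
    ring
  rw [← eval_phasePoly, hsum, hdiv, ← add_assoc, Complex.exp_add, Complex.exp_add,
    Complex.exp_int_mul_two_pi_mul_I, mul_one]
  have h0 : 0 ≤ M % N := Int.emod_nonneg M hNz
  have hlt : M % N < N := Int.emod_lt_of_pos M (by exact_mod_cast hN)
  refine Finset.mem_image.mpr ⟨(M % N).toNat, Finset.mem_range.mpr (by omega), ?_⟩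
  have hc' : (((M % N).toNat : ℕ) : ℂ) = ((M % N : ℤ) : ℂ) := by
    rw [← Int.cast_natCast, Int.toNat_of_nonneg h0]
  rw [hc']

/-- **Rational phases: NOT dense.** If all non-constant coefficients of `p(z₀ + 2πi t)` lie in
`(1/N)ℤ · 2πi`, the exponential points of `{x₁ = p(x₀), y₀ = e^{z₀}}` lie on finitely many curves
`{y₁ = const}` and are not Zariski dense. This generalises the resonant parabola of
`EACDensityOscillatory`. [folklore] -/
theorem not_unprojectedDense_const_of_ratPhases {p : Polynomial ℂ} {z₀ c : ℂ} (hc : exp z₀ = c)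
    {N : ℕ} (hN : 0 < N)
    (hrat : ∀ j, 0 < j → ∃ a : ℤ, (phasePoly p z₀).coeff j * N = a * (2 * Real.pi * I)) :
    ¬ UnprojectedDense (graphPolySurface p (Polynomial.C c)) := by
  obtain ⟨F, hF⟩ := exists_finset_of_ratPhases p z₀ hN hrat
  exact not_unprojectedDense_const_of_finite p hc F hF

end RationalPhases

/-! ## Part E. One irrational phase suffices (Weyl's second differencing) -/

section IrrationalPhase

/-- **An irrational phase at ANY level gives density.** Let `P(t) = p(z₀ + 2πi t) = Σ bⱼ tʲ` with
`Re P` constant on `ℕ`. If for some `s ≥ 1` the coefficients above `s` lie in `(1/N)ℤ · 2πi` and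
`θ` with `θ · 2πi = s! · b_s · N^s` is irrational, then the exponential points of
`{x₁ = p(x₀), y₀ = e^{z₀}}` are Zariski dense: along `k ∈ Nℕ` the phases above `s` are integers
and drop out, and `b_s N^s` becomes the top phase (Part A). [folklore]
[cite: Korobov1992, Thm 26, p. 108] -/
theorem unprojectedDense_const_of_irrational_phase {p : Polynomial ℂ} {z₀ c : ℂ}
    (hc : exp z₀ = c)
    (hR : ∀ k : ℕ, (p.eval (z₀ + k * (2 * Real.pi * I))).re = (p.eval z₀).re)
    {s : ℕ} (hs : 0 < s) {N : ℕ} (hN : 0 < N)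
    (hrat : ∀ j, s < j → ∃ a : ℤ, (phasePoly p z₀).coeff j * N = a * (2 * Real.pi * I))
    {θ : ℝ} (hθ : (θ : ℂ) * (2 * Real.pi * I) =
      (s.factorial : ℂ) * (phasePoly p z₀).coeff s * (N : ℂ) ^ s)
    (hirr : Irrational θ) :
    UnprojectedDense (graphPolySurface p (Polynomial.C c)) := by
  classical
  set P := phasePoly p z₀ with hP
  choose! a ha using hrat
  have hNc : (N : ℂ) ≠ 0 := by exact_mod_cast hN.ne'
  have hPs : P.coeff s ≠ 0 := by
    intro h0
    rw [h0, mul_zero, zero_mul] at hθ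
    have h1 : (θ : ℂ) = 0 := (mul_eq_zero.mp hθ).resolve_right Complex.two_pi_I_ne_zero
    exact hirr.ne_zero (by exact_mod_cast h1)
  -- the truncated, rescaled phase polynomial `g(t) = Σ_{j ≤ s} bⱼ Nʲ tʲ`
  set g : Polynomial ℂ := ∑ j ∈ Finset.range (s + 1),
    Polynomial.C (P.coeff j * (N : ℂ) ^ j) * Polynomial.X ^ j with hg_def
  have hg_coeff : ∀ i, g.coeff i =
      if i ∈ Finset.range (s + 1) then P.coeff i * (N : ℂ) ^ i else 0 := fun i => by
    rw [hg_def, Polynomial.finsetSum_coeff]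
    simp only [Polynomial.coeff_C_mul_X_pow]
    rw [Finset.sum_ite_eq]
  have hgs : g.natDegree ≤ s := Polynomial.natDegree_sum_le_of_forall_le _ _ fun j hj =>
    (Polynomial.natDegree_C_mul_X_pow_le _ _).trans (Nat.lt_succ_iff.mp (Finset.mem_range.mp hj))
  have hgcs : g.coeff s = P.coeff s * (N : ℂ) ^ s := by
    rw [hg_coeff, if_pos (Finset.mem_range.mpr (Nat.lt_succ_self s))]
  have hgd : g.natDegree = s :=
    Polynomial.natDegree_eq_of_le_of_coeff_ne_zero hgs
      (by rw [hgcs]; exact mul_ne_zero hPs (pow_ne_zero _ hNc))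
  have hglc : g.leadingCoeff = P.coeff s * (N : ℂ) ^ s := by
    rw [Polynomial.leadingCoeff, hgd, hgcs]
  have hg_eval : ∀ x : ℂ, g.eval x =
      ∑ j ∈ Finset.range (s + 1), P.coeff j * (N : ℂ) ^ j * x ^ j := fun x => by
    rw [hg_def, Polynomial.eval_finsetSum]
    simp only [Polynomial.eval_mul, Polynomial.eval_C, Polynomial.eval_pow, Polynomial.eval_X]
  -- `P(Nk) = g(k) + (integer)·2πi`
  have hdiff : ∀ k : ℕ, ∃ M : ℤ,
      P.eval ((N : ℂ) * k) = g.eval (k : ℂ) + M * (2 * Real.pi * I) := by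
    intro k
    have hPn : P.natDegree < P.natDegree + s + 1 := by omega
    have hsn : s + 1 ≤ P.natDegree + s + 1 := by omega
    refine ⟨∑ j ∈ Finset.Ico (s + 1) (P.natDegree + s + 1),
      a j * (N : ℤ) ^ (j - 1) * (k : ℤ) ^ j, ?_⟩
    rw [Polynomial.eval_eq_sum_range' hPn, ← Finset.sum_range_add_sum_Ico _ hsn, hg_eval]
    congr 1
    · refine Finset.sum_congr rfl fun j _ => ?_
      rw [mul_pow]
      ring
    · push_cast
      rw [Finset.sum_mul]
      refine Finset.sum_congr rfl fun j hj => ?_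
      have hsj : s < j := (Finset.mem_Ico.mp hj).1
      have hj1 : 1 ≤ j := by omega
      have h := ha j hsj
      have e : ((N : ℂ) * k) ^ j = (N : ℂ) * (N : ℂ) ^ (j - 1) * (k : ℂ) ^ j := by
        rw [mul_pow, ← pow_succ', Nat.sub_add_cancel hj1]
      rw [e]
      linear_combination (N : ℂ) ^ (j - 1) * (k : ℂ) ^ j * h
  have hPeval : ∀ x : ℂ, P.eval x = p.eval (z₀ + x * (2 * Real.pi * I)) := eval_phasePoly p z₀
  -- the hypotheses of Part A along the progression `Nℕ`
  have hg' : ∀ k : ℕ, exp (p.eval (z₀ + ((0 + N * k : ℕ) : ℂ) * (2 * Real.pi * I))) =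
      exp (g.eval (k : ℂ)) := by
    intro k
    obtain ⟨M, hM⟩ := hdiff k
    have e : ((0 + N * k : ℕ) : ℂ) = (N : ℂ) * k := by push_cast; ring
    rw [e, ← hPeval, hM, Complex.exp_eq_exp_iff_exists_int]
    exact ⟨M, rfl⟩
  have hgre : ∀ k : ℕ, (g.eval (k : ℂ)).re = (p.eval z₀).re := by
    intro k
    obtain ⟨M, hM⟩ := hdiff k
    have h1 : g.eval (k : ℂ) = P.eval ((N : ℂ) * k) - M * (2 * Real.pi * I) := by
      rw [hM]; ring
    have h2 := hR (N * k)
    push_cast at h2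
    rw [h1, Complex.sub_re, hPeval, h2]
    simp
  have hR' : ∀ k : ℕ, (g.eval (k : ℂ)).re = (g.eval 0).re := fun k => by
    have h0 := hgre 0
    rw [Nat.cast_zero] at h0
    rw [hgre, h0]
  have hθ' : (θ : ℂ) * (2 * Real.pi * I) = (g.natDegree.factorial : ℂ) * g.leadingCoeff := by
    rw [hgd, hglc, hθ]
    ring
  exact unprojectedDense_const_of_phasePoly hc hN 0 g (by rw [hgd]; exact hs) hg' hR' hθ' hirr

end IrrationalPhase

/-! ## Part F. The complete answer for constant fibres -/

section Complete

/-- If all non-constant coefficients of `Q` have vanishing real part, `rePart Q` is the constant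
`Re b₀`. [folklore] -/
theorem rePart_eq_C_of_forall {Q : Polynomial ℂ} (h : ∀ j, 0 < j → (Q.coeff j).re = 0) :
    rePart Q = Polynomial.C (Q.coeff 0).re := by
  ext i
  rw [coeff_rePart, Polynomial.coeff_C]
  rcases Nat.eq_zero_or_pos i with rfl | hi
  · simp
  · rw [if_neg hi.ne', h i hi]

/-- **Constant fibres: the complete answer.** For `S = {x₁ = p(x₀), y₀ = e^{z₀}}` (any
`p ∈ ℂ[x]`, any `z₀`), the exponential points `S ∩ Γ_exp` are Zariski dense in `S` if and only if
NOT every non-constant coefficient of `P(t) = p(z₀ + 2πi t)` lies in `ℚ · 2πi`.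
Proof: rational phases ⇒ finitely many values of `y₁` (Part D); a coefficient with non-zero real
part ⇒ linear drift of `Re P` ⇒ super-decay or super-growth (Part B with the engines of
`EACDensityFamilies` / `EACDensityGrowth`); all real parts zero and some phase irrational ⇒ Weyl
differencing at the top irrational level (Part E). (new in this file) [folklore] -/
theorem unprojectedDense_const_iff {p : Polynomial ℂ} {z₀ c : ℂ} (hc : exp z₀ = c) :
    UnprojectedDense (graphPolySurface p (Polynomial.C c)) ↔
      ¬ ∀ j, 0 < j → ∃ r : ℚ, (phasePoly p z₀).coeff j = (r : ℂ) * (2 * Real.pi * I) := by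
  classical
  set P := phasePoly p z₀ with hP
  have hPeval : ∀ x : ℂ, P.eval x = p.eval (z₀ + x * (2 * Real.pi * I)) := eval_phasePoly p z₀
  constructor
  · intro hD hall
    obtain ⟨N, hN, hint⟩ := exists_int_phases_of_rat_phases P hall
    exact not_unprojectedDense_const_of_ratPhases hc hN hint hD
  · intro hnot
    by_cases hre : ∀ j, 0 < j → (P.coeff j).re = 0
    · -- OSCILLATORY: all non-constant coefficients purely imaginary; real phases `β j`
      set β : ℕ → ℝ := fun j => (P.coeff j).im / (2 * Real.pi) with hβ_def
      have hβ : ∀ j, 0 < j → P.coeff j = ((β j : ℝ) : ℂ) * (2 * Real.pi * I) := fun j hj => by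
        have e : ((β j : ℝ) : ℂ) * (2 * Real.pi * I) = (((β j) * (2 * Real.pi) : ℝ) : ℂ) * I := by
          push_cast
          ring
        rw [e]
        apply Complex.ext
        · rw [Complex.mul_I_re, Complex.ofReal_im, neg_zero]
          exact hre j hj
        · rw [Complex.mul_I_im, Complex.ofReal_re, hβ_def]
          dsimp only
          rw [div_mul_cancel₀ _ Real.two_pi_pos.ne']
      have hβ0 : ∀ j, P.coeff j = 0 → β j = 0 := fun j h0 => by simp [hβ_def, h0]
      -- some phase is irrational
      have hex : ∃ j, 0 < j ∧ Irrational (β j) := by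
        by_contra hcon
        push Not at hcon
        refine hnot fun j hj => ?_
        have hq : ¬ Irrational (β j) := hcon j hj
        unfold Irrational at hq
        rw [not_not, Set.mem_range] at hq
        obtain ⟨r, hr⟩ := hq
        exact ⟨r, by rw [hβ j hj, ← hr, Complex.ofReal_ratCast]⟩
      -- the top irrational phase `s`
      set T := (Finset.range (P.natDegree + 1)).filter fun j => 0 < j ∧ Irrational (β j) with hT
      have hTne : T.Nonempty := by
        obtain ⟨j, hj, hirr⟩ := hex
        refine ⟨j, Finset.mem_filter.mpr ⟨Finset.mem_range.mpr ?_, hj, hirr⟩⟩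
        by_contra hjd
        rw [not_lt] at hjd
        exact hirr.ne_zero (hβ0 j
          (Polynomial.coeff_eq_zero_of_natDegree_lt (Nat.lt_of_succ_le hjd)))
      set s := T.max' hTne with hs_def
      obtain ⟨-, hs0, hsirr⟩ := Finset.mem_filter.mp (Finset.max'_mem T hTne)
      have habove : ∀ j, s < j → ¬ Irrational (β j) := by
        intro j hj hirr
        by_cases hjd : j < P.natDegree + 1
        · have hjT : j ∈ T :=
            Finset.mem_filter.mpr ⟨Finset.mem_range.mpr hjd, lt_trans hs0 hj, hirr⟩
          have hle : j ≤ s := by rw [hs_def]; exact Finset.le_max' T j hjT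
          exact absurd hle (not_le.mpr hj)
        · exact hirr.ne_zero (hβ0 j (Polynomial.coeff_eq_zero_of_natDegree_lt (by omega)))
      -- the phases above `s` are rational, with a common denominator
      have hratQ : ∀ j, s < j → ∃ r : ℚ, P.coeff j = (r : ℂ) * (2 * Real.pi * I) := by
        intro j hj
        have h1 := habove j hj
        unfold Irrational at h1
        rw [not_not, Set.mem_range] at h1
        obtain ⟨r, hr⟩ := h1
        exact ⟨r, by rw [hβ j (lt_trans hs0 hj), ← hr, Complex.ofReal_ratCast]⟩
      obtain ⟨N, hN, hint⟩ := exists_int_phases_of_rat_phases P hratQ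
      -- `θ = s! β_s N^s`
      have hθirr : Irrational ((s.factorial : ℕ) * β s * ((N ^ s : ℕ) : ℝ)) :=
        (hsirr.natCast_mul (Nat.factorial_ne_zero s)).mul_natCast (pow_ne_zero s hN.ne')
      have hθ : (((s.factorial : ℕ) * β s * ((N ^ s : ℕ) : ℝ) : ℝ) : ℂ) * (2 * Real.pi * I) =
          (s.factorial : ℂ) * P.coeff s * (N : ℂ) ^ s := by
        rw [hβ s hs0]
        push_cast
        ring
      -- `Re p` is constant on the progression
      have h1 : ∀ x : ℝ, (p.eval (z₀ + (x : ℂ) * (2 * Real.pi * I))).re = (P.coeff 0).re :=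
        fun x => by
        rw [← hPeval, ← eval_rePart, rePart_eq_C_of_forall hre, Polynomial.eval_C]
      have hRe : ∀ k : ℕ, (p.eval (z₀ + k * (2 * Real.pi * I))).re = (p.eval z₀).re := by
        intro k
        have h2 := h1 k
        have h3 := h1 0
        simp only [Complex.ofReal_natCast] at h2
        simp only [Complex.ofReal_zero, zero_mul, add_zero] at h3
        rw [h2, h3]
      exact unprojectedDense_const_of_irrational_phase hc hRe hs0 hN hint hθ hθirr
    · -- DRIFT: a coefficient with non-zero real part
      push Not at hre
      obtain ⟨j, hj, hjre⟩ := hre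
      set R := rePart P with hR_def
      have hRj : R.coeff j ≠ 0 := by rwa [hR_def, coeff_rePart]
      have hRd : 0 < R.natDegree := lt_of_lt_of_le hj (Polynomial.le_natDegree_of_ne_zero hRj)
      have hR0 : R ≠ 0 := fun h => hRj (by rw [h, Polynomial.coeff_zero])
      have hRlc : R.leadingCoeff ≠ 0 := Polynomial.leadingCoeff_ne_zero.mpr hR0
      have hRev : ∀ x : ℝ, R.eval x = (p.eval (z₀ + (x : ℂ) * (2 * Real.pi * I))).re :=
        fun x => by rw [hR_def, eval_rePart, hPeval]
      have e : ∀ k : ℕ, z₀ + (k : ℂ) * (((1 : ℤ) : ℂ) * (2 * Real.pi * I)) =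
          z₀ + ((k : ℝ) : ℂ) * (2 * Real.pi * I) := fun k => by
        push_cast
        ring
      rcases hRlc.lt_or_gt with hneg | hpos
      · -- decay
        have h1 : 0 < (-R).leadingCoeff := by rw [Polynomial.leadingCoeff_neg]; linarith
        have h2 : 0 < (-R).natDegree := by rwa [Polynomial.natDegree_neg]
        refine unprojectedDense_const_of_negDrift hc 1 (Or.inl rfl) (half_pos h1) ?_
        filter_upwards [eventually_mul_le_eval_of_leadingCoeff_pos (-R) h2 h1] with k hk
        rw [Polynomial.eval_neg, hRev] at hk
        rw [e k]
        exact hk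
      · -- growth
        refine unprojectedDense_const_of_posDrift hc 1 (Or.inl rfl) (half_pos hpos) ?_
        filter_upwards [eventually_mul_le_eval_of_leadingCoeff_pos R hRd hpos] with k hk
        rw [hRev] at hk
        rw [e k]
        exact hk

/-- **Equivalently: Zariski dense iff `y₁` takes infinitely many values on the exponential points**
(iff the exponential points do not lie on finitely many curves `{y₁ = const}`). [folklore] -/
theorem unprojectedDense_const_iff_infinite {p : Polynomial ℂ} {z₀ c : ℂ} (hc : exp z₀ = c) :
    UnprojectedDense (graphPolySurface p (Polynomial.C c)) ↔
      Set.Infinite (Set.range fun k : ℤ => exp (p.eval (z₀ + k * (2 * Real.pi * I)))) := by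
  classical
  constructor
  · intro hD
    by_contra hfin
    rw [Set.not_infinite] at hfin
    exact not_unprojectedDense_const_of_finite p hc hfin.toFinset
      (fun k => hfin.mem_toFinset.mpr ⟨k, rfl⟩) hD
  · intro hinf
    rw [unprojectedDense_const_iff hc]
    intro hall
    obtain ⟨N, hN, hint⟩ := exists_int_phases_of_rat_phases (phasePoly p z₀) hall
    obtain ⟨F, hF⟩ := exists_finset_of_ratPhases p z₀ hN hint
    exact hinf (Set.Finite.subset F.finite_toSet (by rintro _ ⟨k, rfl⟩; exact hF k))

/-- **With the case certificate**: for `deg p ≥ 2`, `c ≠ 0`, the constant-fibre surface is in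
Mantova–Masser's case (dim-pi-S-1-free), and its exponential points are dense iff some phase is
irrational (in the above sense). Both answers occur (`EACDensityOscillatory`: the resonant parabola
NO, the cubic YES); the free form of the question is untouched (these surfaces are never
multiplicatively free). [folklore] [cite: MantovaMasser2023, §1 Further remarks, p. 5] -/
theorem mmCase_and_unprojectedDense_const_iff {p : Polynomial ℂ} (hd : 2 ≤ p.natDegree)
    {z₀ c : ℂ} (hc : exp z₀ = c) :
    MMCaseDimPiOneFree (graphPolySurface p (Polynomial.C c)) ∧
      (UnprojectedDense (graphPolySurface p (Polynomial.C c)) ↔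
        Set.Infinite (Set.range fun k : ℤ => exp (p.eval (z₀ + k * (2 * Real.pi * I))))) :=
  ⟨mmCase_graphPolySurface_C hd (by rw [← hc]; exact Complex.exp_ne_zero _),
    unprojectedDense_const_iff_infinite hc⟩

end Complete

/-! ## Part G. Examples: an integer top phase drops out; a half-integer one needs `q = 2` -/

section Examples

/-- `π` is irrational (from the tree's Lindemann–Weierstrass theorem), hence so is `m π` for every
non-zero integer `m`. [cite: Lindemann1882] -/
theorem irrational_int_mul_pi {m : ℤ} (hm : m ≠ 0) : Irrational ((m : ℝ) * Real.pi) :=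
  transcendental_pi_holds.irrational.intCast_mul hm

/-- `{x₁ = x₀³/(4π²) + i x₀², y₀ = 1}`: here `p(2πik) = -2πi k³ - 4π² i k²`; the top phase `-k³` is
an INTEGER and drops out of `y₁ = e^{p} = e^{-4π² i k²}`, whose top phase `-4π` (at level 2) is
irrational: dense by Part A with `q = 1`, `g = -4π² i X²`. [folklore] -/
def integerTopPhaseSurface : Set (Fin 2 ⊕ Fin 2 → ℂ) :=
  graphPolySurface (Polynomial.C ((4 * (Real.pi : ℂ) ^ 2)⁻¹) * Polynomial.X ^ 3 +
    Polynomial.C I * Polynomial.X ^ 2) (Polynomial.C 1)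

/-- The values of `x₀³/(4π²) + i x₀²` at `x₀ = 2πik`. [folklore] -/
theorem eval_integerTopPhase (k : ℂ) :
    (Polynomial.C ((4 * (Real.pi : ℂ) ^ 2)⁻¹) * Polynomial.X ^ 3 +
        Polynomial.C I * Polynomial.X ^ 2).eval (k * (2 * Real.pi * I)) =
      -(4 * Real.pi ^ 2 * I) * k ^ 2 + (-k ^ 3) * (2 * Real.pi * I) := by
  have hπ : (Real.pi : ℂ) ≠ 0 := by exact_mod_cast Real.pi_ne_zero
  have hI3 : I ^ 3 = -I := by rw [pow_succ, Complex.I_sq]; ring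
  simp only [Polynomial.eval_add, Polynomial.eval_mul, Polynomial.eval_C, Polynomial.eval_pow,
    Polynomial.eval_X, mul_pow, hI3, Complex.I_sq]
  field_simp
  ring

/-- **`{x₁ = x₀³/(4π²) + i x₀², y₀ = 1}` has Zariski-dense exponential points** although its top
phase is rational (an integer). [folklore] -/
theorem unprojectedDense_integerTopPhaseSurface : UnprojectedDense integerTopPhaseSurface := by
  have hg2 : (Polynomial.C (-(4 * (Real.pi : ℂ) ^ 2 * I)) * Polynomial.X ^ 2).natDegree = 2 := by
    rw [Polynomial.natDegree_C_mul_X_pow]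
    have hπ : (Real.pi : ℂ) ≠ 0 := by exact_mod_cast Real.pi_ne_zero
    exact neg_ne_zero.mpr (mul_ne_zero (mul_ne_zero (by norm_num) (pow_ne_zero 2 hπ)) I_ne_zero)
  refine unprojectedDense_const_of_phasePoly (z₀ := 0) Complex.exp_zero one_pos 0
    (Polynomial.C (-(4 * (Real.pi : ℂ) ^ 2 * I)) * Polynomial.X ^ 2) (by rw [hg2]; norm_num)
    (fun k => ?_) (fun k => ?_) (θ := ((-4 : ℤ) : ℝ) * Real.pi) ?_ (irrational_int_mul_pi (by norm_num))
  · have e : ((0 + 1 * k : ℕ) : ℂ) = k := by push_cast; ring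
    rw [zero_add, e, eval_integerTopPhase, Complex.exp_eq_exp_iff_exists_int]
    refine ⟨-(k : ℤ) ^ 3, ?_⟩
    simp only [Polynomial.eval_mul, Polynomial.eval_C, Polynomial.eval_pow, Polynomial.eval_X]
    push_cast
    ring
  · have e : ∀ x : ℝ, ((Polynomial.C (-(4 * (Real.pi : ℂ) ^ 2 * I)) * Polynomial.X ^ 2).eval
        (x : ℂ)).re = 0 := fun x => by
      have h : (Polynomial.C (-(4 * (Real.pi : ℂ) ^ 2 * I)) * Polynomial.X ^ 2).eval (x : ℂ) =
          ((-(4 * Real.pi ^ 2 * x ^ 2) : ℝ) : ℂ) * I := by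
        simp only [Polynomial.eval_mul, Polynomial.eval_C, Polynomial.eval_pow, Polynomial.eval_X]
        push_cast
        ring
      rw [h, Complex.mul_I_re, Complex.ofReal_im, neg_zero]
    have h1 := e k
    have h0 := e 0
    rw [Complex.ofReal_natCast] at h1
    rw [Complex.ofReal_zero] at h0
    rw [h1, h0]
  · rw [Polynomial.leadingCoeff, hg2, Polynomial.coeff_C_mul_X_pow, if_pos rfl]
    push_cast
    ring

/-- Its case certificate (`deg = 3 ≥ 2`, `c = 1 ≠ 0`) and density together. [folklore]
[cite: MantovaMasser2023, §1 Further remarks, p. 5] -/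
theorem unprojectedDensityQuestion_instance_integerTopPhaseSurface :
    MMCaseDimPiOneFree integerTopPhaseSurface ∧ UnprojectedDense integerTopPhaseSurface := by
  refine ⟨mmCase_graphPolySurface_C ?_ one_ne_zero, unprojectedDense_integerTopPhaseSurface⟩
  have hπ : (Real.pi : ℂ) ≠ 0 := by exact_mod_cast Real.pi_ne_zero
  have h3 : (Polynomial.C ((4 * (Real.pi : ℂ) ^ 2)⁻¹) * Polynomial.X ^ 3).natDegree = 3 := by
    rw [Polynomial.natDegree_C_mul_X_pow]
    exact inv_ne_zero (mul_ne_zero (by norm_num) (pow_ne_zero 2 hπ))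
  have h2 : (Polynomial.C I * Polynomial.X ^ 2 : Polynomial ℂ).natDegree = 2 := by
    rw [Polynomial.natDegree_C_mul_X_pow _ _ I_ne_zero]
  rw [Polynomial.natDegree_add_eq_left_of_natDegree_lt (by rw [h2, h3]; norm_num), h3]
  norm_num

/-- `{x₁ = x₀³/(8π²) + i x₀², y₀ = 1}`: now `p(2πik) = -πi k³ - 4π² i k²`, the top phase `-k³/2`
is a HALF-integer; along the EVEN integers `k = 2m` it drops out and
`y₁ = e^{-16π² i m²}` has irrational top phase `-16π`: dense by Part A with `q = 2`. [folklore] -/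
def halfIntegerTopPhaseSurface : Set (Fin 2 ⊕ Fin 2 → ℂ) :=
  graphPolySurface (Polynomial.C ((8 * (Real.pi : ℂ) ^ 2)⁻¹) * Polynomial.X ^ 3 +
    Polynomial.C I * Polynomial.X ^ 2) (Polynomial.C 1)

/-- The values of `x₀³/(8π²) + i x₀²` at `x₀ = 2πi(2m)`. [folklore] -/
theorem eval_halfIntegerTopPhase (m : ℂ) :
    (Polynomial.C ((8 * (Real.pi : ℂ) ^ 2)⁻¹) * Polynomial.X ^ 3 +
        Polynomial.C I * Polynomial.X ^ 2).eval ((2 * m) * (2 * Real.pi * I)) =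
      -(16 * Real.pi ^ 2 * I) * m ^ 2 + (-4 * m ^ 3) * (2 * Real.pi * I) := by
  have hπ : (Real.pi : ℂ) ≠ 0 := by exact_mod_cast Real.pi_ne_zero
  have hI3 : I ^ 3 = -I := by rw [pow_succ, Complex.I_sq]; ring
  simp only [Polynomial.eval_add, Polynomial.eval_mul, Polynomial.eval_C, Polynomial.eval_pow,
    Polynomial.eval_X, mul_pow, hI3, Complex.I_sq]
  field_simp
  ring

/-- **`{x₁ = x₀³/(8π²) + i x₀², y₀ = 1}` has Zariski-dense exponential points** (second-level
differencing along `k ∈ 2ℕ`). [folklore] [cite: Korobov1992, Thm 26, p. 108] -/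
theorem unprojectedDense_halfIntegerTopPhaseSurface :
    UnprojectedDense halfIntegerTopPhaseSurface := by
  have hg2 : (Polynomial.C (-(16 * (Real.pi : ℂ) ^ 2 * I)) * Polynomial.X ^ 2).natDegree = 2 := by
    rw [Polynomial.natDegree_C_mul_X_pow]
    have hπ : (Real.pi : ℂ) ≠ 0 := by exact_mod_cast Real.pi_ne_zero
    exact neg_ne_zero.mpr (mul_ne_zero (mul_ne_zero (by norm_num) (pow_ne_zero 2 hπ)) I_ne_zero)
  refine unprojectedDense_const_of_phasePoly (z₀ := 0) Complex.exp_zero two_pos 0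
    (Polynomial.C (-(16 * (Real.pi : ℂ) ^ 2 * I)) * Polynomial.X ^ 2) (by rw [hg2]; norm_num)
    (fun k => ?_) (fun k => ?_) (θ := ((-16 : ℤ) : ℝ) * Real.pi) ?_
    (irrational_int_mul_pi (by norm_num))
  · have e : ((0 + 2 * k : ℕ) : ℂ) = 2 * k := by push_cast; ring
    rw [zero_add, e, eval_halfIntegerTopPhase, Complex.exp_eq_exp_iff_exists_int]
    refine ⟨-4 * (k : ℤ) ^ 3, ?_⟩
    simp only [Polynomial.eval_mul, Polynomial.eval_C, Polynomial.eval_pow, Polynomial.eval_X]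
    push_cast
    ring
  · have e : ∀ x : ℝ, ((Polynomial.C (-(16 * (Real.pi : ℂ) ^ 2 * I)) * Polynomial.X ^ 2).eval
        (x : ℂ)).re = 0 := fun x => by
      have h : (Polynomial.C (-(16 * (Real.pi : ℂ) ^ 2 * I)) * Polynomial.X ^ 2).eval (x : ℂ) =
          ((-(16 * Real.pi ^ 2 * x ^ 2) : ℝ) : ℂ) * I := by
        simp only [Polynomial.eval_mul, Polynomial.eval_C, Polynomial.eval_pow, Polynomial.eval_X]
        push_cast
        ring
      rw [h, Complex.mul_I_re, Complex.ofReal_im, neg_zero]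
    have h1 := e k
    have h0 := e 0
    rw [Complex.ofReal_natCast] at h1
    rw [Complex.ofReal_zero] at h0
    rw [h1, h0]
  · rw [Polynomial.leadingCoeff, hg2, Polynomial.coeff_C_mul_X_pow, if_pos rfl]
    push_cast
    ring

end Examples

end Literature.ModelTheory.Zilber
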